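import Summits.CriticalPhenomena.PercolationContinuityZ3.Theses.PercExchangeRateTransport

/-!
# Line `birth` — registered skeleton for the crux `ModelFacts`
# (stmt-CriticalPhenomena-16064, route `PercExchangeRateTransport`, ledger rank 9, binder `hMF` of `closes`)

Crux (fixed, by name): `PercExchangeRateTransport.ModelFacts` — the bookkeeping facts for the
label-coupled anisotropic bond-percolation family on `ℤ²×ℤ` (labels `U_e` i.i.d. uniform on
`[0,1]` under `labelMeasure (Site 3)`; an `x`/`y`-bond `e` is open iff `U_e ≤ p`, a `z`-bond iff
`U_e ≤ t`; `Θ n p t = P(0 ↔ ∂Λ_n in Λ_n)`, `θ p t = P(|C(0)| = ∞)`), a conjunction of TEN clauses: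
(1) each `Θ_n` continuous on `ℝ²`; (2) `C¹` on the open square; (3) nondecreasing in `p`;
(4) nondecreasing in `t`; (5) nonincreasing in `n`; (6) valued in `[0,1]`; (7) `θ = ⨅ n, Θ_n`;
(8) `∂_p Θ_n > 0` on the open square for `n ≥ 1`; (9) the diagonal `t = p` is bond percolation on
`ℤ³` (`θ p p = theta (zdGraph 3) 0 p`); (10) the planar end `t = 0` is bond percolation on `ℤ²`
(`θ p 0 = theta (zdGraph 2) 0 p`).

THE LINE: the ten clauses group by the ONE ingredient each group needs, giving four genuine
lemmas (the registered stubs), none of which is the crux and none of which mentions `θ(p_c)`: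

* `stub_regularity`  = (1) ∧ (2): CYLINDER DECOMPOSITION — `{0 ↔ ∂Λ_n in Λ_n}` is determined by
  the finitely many bonds of `Λ_n`, so `Θ_n(p,t) = P_n(clamp p, clamp t)` for a polynomial `P_n`
  with nonnegative coefficients in the Bernstein form (`prodBernoulli_real_eq_sum_powerset`,
  `RussoPath.prodBernoulli_real_localCylinder_eq`); the clamp `Set.projIcc` is continuous, whence
  continuity on all of `ℝ²` (labels lie in `[0,1]` a.s., so `Θ_n` is constant in each variable
  outside `[0,1]`) and real-analyticity, a fortiori `C¹`, on `(0,1)²`. Needs the two-parameter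
  push-forward `labelMeasure.map (cfg p t) = prodBernoulli (edge-dependent parameter)`, NOT in
  tree (only the one-parameter `map_configOfLabels`). Size M–L.
* `stub_coupling`    = (3) ∧ (4) ∧ (5) ∧ (6) ∧ (7): MONOTONE COUPLING + CONTINUITY FROM ABOVE —
  pathwise `cfg p t U ⊆ cfg p' t' U` for `p ≤ p'`, `t ≤ t'` and `siteToBoundary` increasing give
  (3), (4) (`DCT16.isUpperSet_siteToBoundary`); the set-level first-exit lemma
  `Literature.Barriers.CriticalPhenomena.mem_siteToBoundary_of_le` (`m ≤ n`, needs `ω ⊆ E(ℤ³)`,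
  which `cfg p t U` satisfies BY DEFINITION, so (5) holds for every label field, not just a.s.)
  gives (5); `isProbabilityMeasure_labelMeasure` gives (6); and
  `percolatesAt 0 = ⋂ n, siteToBoundary 3 n` (`percolatesAt_eq_iInter` /
  `iInter_siteToBoundary_subset_percolatesAt`) with continuity from above of the pulled-back
  events (MEASURABILITY of `{U | cfg p t U ∈ siteToBoundary 3 n}` must be shown — the crux's own
  "why it might fail"; `DCT16.measurableSet_siteToBoundary` + measurability of `U ↦ cfg p t U`)
  gives (7) (template: `DCT16.tendsto_real_siteToBoundary` / `SharpnessDCTProofs.lean:589–615`,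
  `measure_iInter` of an antitone sequence of null-measurable sets). Size M.
* `stub_derivPos`    = (8): TWO-PARAMETER RUSSO — `∂_pΘ_n = Σ_{horizontal e ∈ Λ_n} P(e pivotal)`
  (`hasDerivAt_prodBernoulli_real`), and for `n ≥ 1`, `0 < p, t < 1` the configuration "straight
  `x`-path from `0` to `∂Λ_n` open, every other bond of `Λ_n` closed" has positive weight and makes
  its first bond pivotal. No tree lemma of this form (the pivotal files are 2D-critical). Size L.
* `stub_slices`      = (9) ∧ (10): SLICE IDENTIFICATIONS — on the diagonal `cfg p p U =
  configOfLabels p U (zdGraph 3)` as sets (case split `vert e ∨ ¬ vert e`), then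
  `map_configOfLabels_holds` (PROVED in tree) gives (9); at `t = 0` a.s. no vertical bond is open
  (`{U_e ≤ 0}` is null, countably many `e`; `ae_forall_ne_labelMeasure`-type lemmas), the cluster
  of `0` lives in the layer `ℤ²×{0}` whose bonds are i.i.d. Bernoulli(`p`), and `theta` must be
  transported along the graph embedding `zdGraph 2 ↪ zdGraph 3` (no such transport lemma in tree).
  Size L (the planar half is the largest single piece of the crux).
* `ModelFacts_of (h1 : Stubs.stub_regularity) (h2 : Stubs.stub_coupling) (h3 : Stubs.stub_derivPos)
  (h4 : Stubs.stub_slices) : PercExchangeRateTransport.ModelFacts` — PROVED (no `sorry`): the four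
  stub `Prop`s are the crux's clauses with its `let`-prefix (`μ`, `vert`, `cfg`, `Θ`, `θ`)
  SUBSTITUTED IN (ζ-reduced, self-contained text over tree declarations only — the registrar
  records a stub's signature verbatim and a `let … :=` inside it cannot be registered), so after
  `dsimp only` (δ + ζ) on the crux the ten clauses are reassembled in the crux's order; the
  section `LetForm` restates each stub with the crux's `let`-prefix VERBATIM and certifies
  `LetForm.X ↔ Stubs.stub_X` by `Iff.rfl` (the stubs are literally clauses of the crux).
* `ModelFacts_proof : ModelFacts := ModelFacts_of stub_regularity stub_coupling stub_derivPos
  stub_slices` — the skeleton IS the crux proof once the four sorries are discharged (it also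
  certifies that each registered `theorem stub_*` has exactly the type `Stubs.stub_*`). A stub
  prover lands `theorem stub_<name> : <registered signature>` in `Theorems/` with
  `--supports stmt-CriticalPhenomena-16064`; the sorried stub here is then discharged by name.

Hardest stub: `stub_slices` (planar half: graph-embedding transport of `theta` + an a.s.
modification), then `stub_derivPos` (a positive pivotal configuration in the two-parameter Russo
formula). Grounder notes g51-4 / g51-6 (2026-08-16) list the tree components per clause; this cut
follows them. Disproof used: none filed for this crux (`ledger crux ls stmt-CriticalPhenomena-16064`:
no workfiles, 2026-08-17; no `Theorems/ModelFacts/Negative/*`). Negatives index: no entry concerns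
the anisotropic family. No new route, no restatement of the crux, no proving beyond the assembly.
-/

noncomputable section

open MeasureTheory
open Literature.Probability.Percolation Literature.Probability.LatticeModels

namespace Summit.CriticalPhenomena.PercolationContinuityZ3.Cruxes.ModelFacts.Birth

/-! ## The four registered stubs: precise `Prop`s `Stubs.stub_*` + sorried theorems `stub_*`

Every stub is a group of clauses of the crux with the crux's `let`-prefix (`μ`, `vert`, `cfg`, `Θ`,
`θ`) substituted in, i.e. self-contained text over tree declarations (`labelMeasure`, `zdGraph`,
`siteToBoundary`, `percolatesAt`, `theta`), exactly as a stub prover restates it in `Theorems/`. -/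

namespace Stubs

/-- **Stub `Prop` 1 (regularity = clauses (1) ∧ (2) of the crux, ζ-reduced)** — writing
`Θ n p t := (labelMeasure (Site 3)).real {U | cfg p t U ∈ siteToBoundary 3 n}` with
`cfg p t U := {e ∈ E(ℤ³) | (e vertical ∧ U e ≤ t) ∨ (e horizontal ∧ U e ≤ p)}`: every finite-volume
one-arm probability `Θ_n` of the anisotropic family is continuous on `ℝ²` and `C¹` on the open
unit square (a polynomial in the clamped parameters: cylinder decomposition over the bonds of
`Λ_n`). -/
def stub_regularity : Prop :=
  (∀ n : ℕ, Continuous (fun x : ℝ × ℝ =>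
        (labelMeasure (Site 3)).real {U |
          {e | e ∈ (zdGraph 3).edgeSet ∧
              (((∃ x : Site 3, e = s(x, x + Pi.single (2 : Fin 3) 1)) ∧ U e ≤ x.2) ∨
                (¬ (∃ x : Site 3, e = s(x, x + Pi.single (2 : Fin 3) 1)) ∧ U e ≤ x.1))} ∈
            siteToBoundary 3 n})) ∧
      (∀ n : ℕ, ContDiffOn ℝ 1 (fun x : ℝ × ℝ =>
        (labelMeasure (Site 3)).real {U |
          {e | e ∈ (zdGraph 3).edgeSet ∧
              (((∃ x : Site 3, e = s(x, x + Pi.single (2 : Fin 3) 1)) ∧ U e ≤ x.2) ∨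
                (¬ (∃ x : Site 3, e = s(x, x + Pi.single (2 : Fin 3) 1)) ∧ U e ≤ x.1))} ∈
            siteToBoundary 3 n})
        (Set.Ioo 0 1 ×ˢ Set.Ioo 0 1))

/-- **Stub `Prop` 2 (monotone coupling = clauses (3) ∧ (4) ∧ (5) ∧ (6) ∧ (7), ζ-reduced)** —
`Θ_n(p,t)` is nondecreasing in `p` and in `t` (pathwise coupling), nonincreasing in `n` (first
exit: `siteToBoundary 3 n ⊆ siteToBoundary 3 m` for `m ≤ n` on configurations inside `E(ℤ³)`),
valued in `[0,1]`, and `θ(p,t) := (labelMeasure (Site 3)).real {U | cfg p t U ∈ percolatesAt 0}`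
equals `⨅ n, Θ_n(p,t)` (continuity from above along `percolatesAt 0 = ⋂ n, siteToBoundary 3 n`,
measurability of the pulled-back events included). -/
def stub_coupling : Prop :=
  (∀ (n : ℕ) (t : ℝ), Monotone (fun p : ℝ =>
        (labelMeasure (Site 3)).real {U |
          {e | e ∈ (zdGraph 3).edgeSet ∧
              (((∃ x : Site 3, e = s(x, x + Pi.single (2 : Fin 3) 1)) ∧ U e ≤ t) ∨
                (¬ (∃ x : Site 3, e = s(x, x + Pi.single (2 : Fin 3) 1)) ∧ U e ≤ p))} ∈
            siteToBoundary 3 n})) ∧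
      (∀ (n : ℕ) (p : ℝ), Monotone (fun t : ℝ =>
        (labelMeasure (Site 3)).real {U |
          {e | e ∈ (zdGraph 3).edgeSet ∧
              (((∃ x : Site 3, e = s(x, x + Pi.single (2 : Fin 3) 1)) ∧ U e ≤ t) ∨
                (¬ (∃ x : Site 3, e = s(x, x + Pi.single (2 : Fin 3) 1)) ∧ U e ≤ p))} ∈
            siteToBoundary 3 n})) ∧
      (∀ (p t : ℝ), Antitone (fun n : ℕ =>
        (labelMeasure (Site 3)).real {U |
          {e | e ∈ (zdGraph 3).edgeSet ∧
              (((∃ x : Site 3, e = s(x, x + Pi.single (2 : Fin 3) 1)) ∧ U e ≤ t) ∨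
                (¬ (∃ x : Site 3, e = s(x, x + Pi.single (2 : Fin 3) 1)) ∧ U e ≤ p))} ∈
            siteToBoundary 3 n})) ∧
      (∀ (n : ℕ) (p t : ℝ),
        0 ≤ (labelMeasure (Site 3)).real {U |
              {e | e ∈ (zdGraph 3).edgeSet ∧
                  (((∃ x : Site 3, e = s(x, x + Pi.single (2 : Fin 3) 1)) ∧ U e ≤ t) ∨
                    (¬ (∃ x : Site 3, e = s(x, x + Pi.single (2 : Fin 3) 1)) ∧ U e ≤ p))} ∈
                siteToBoundary 3 n} ∧
        (labelMeasure (Site 3)).real {U |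
          {e | e ∈ (zdGraph 3).edgeSet ∧
              (((∃ x : Site 3, e = s(x, x + Pi.single (2 : Fin 3) 1)) ∧ U e ≤ t) ∨
                (¬ (∃ x : Site 3, e = s(x, x + Pi.single (2 : Fin 3) 1)) ∧ U e ≤ p))} ∈
            siteToBoundary 3 n} ≤ 1) ∧
      (∀ (p t : ℝ),
        (labelMeasure (Site 3)).real {U |
          {e | e ∈ (zdGraph 3).edgeSet ∧
              (((∃ x : Site 3, e = s(x, x + Pi.single (2 : Fin 3) 1)) ∧ U e ≤ t) ∨
                (¬ (∃ x : Site 3, e = s(x, x + Pi.single (2 : Fin 3) 1)) ∧ U e ≤ p))} ∈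
            percolatesAt (0 : Site 3)} =
        ⨅ n : ℕ, (labelMeasure (Site 3)).real {U |
            {e | e ∈ (zdGraph 3).edgeSet ∧
                (((∃ x : Site 3, e = s(x, x + Pi.single (2 : Fin 3) 1)) ∧ U e ≤ t) ∨
                  (¬ (∃ x : Site 3, e = s(x, x + Pi.single (2 : Fin 3) 1)) ∧ U e ≤ p))} ∈
              siteToBoundary 3 n})

/-- **Stub `Prop` 3 (Russo positivity = clause (8), ζ-reduced)** — for `n ≥ 1` and `(p,t)` in
the open unit square, `∂_p Θ_n(p,t) > 0` (two-parameter Russo formula: the derivative is the sum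
of the pivotality probabilities of the horizontal bonds of `Λ_n`, and the straight `x`-path from
`0` to `∂Λ_n` is pivotal with positive probability). -/
def stub_derivPos : Prop :=
  ∀ n : ℕ, 1 ≤ n → ∀ p ∈ Set.Ioo (0 : ℝ) 1, ∀ t ∈ Set.Ioo (0 : ℝ) 1,
      0 < deriv (fun q : ℝ =>
        (labelMeasure (Site 3)).real {U |
          {e | e ∈ (zdGraph 3).edgeSet ∧
              (((∃ x : Site 3, e = s(x, x + Pi.single (2 : Fin 3) 1)) ∧ U e ≤ t) ∨
                (¬ (∃ x : Site 3, e = s(x, x + Pi.single (2 : Fin 3) 1)) ∧ U e ≤ q))} ∈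
            siteToBoundary 3 n}) p

/-- **Stub `Prop` 4 (slice identifications = clauses (9) ∧ (10), ζ-reduced)** — the diagonal
`t = p` of the family is bond percolation on `ℤ³` (`θ(p,p) = θ_{ℤ³}(p)`, via
`map_configOfLabels_holds`), and the planar end `t = 0` is a.s. bond percolation on the layer
`ℤ²×{0}` (`θ(p,0) = θ_{ℤ²}(p)`, via the null set "some vertical bond has label `≤ 0`" and the
graph embedding `zdGraph 2 ↪ zdGraph 3`). -/
def stub_slices : Prop :=
  (∀ p : unitInterval,
        (labelMeasure (Site 3)).real {U |
          {e | e ∈ (zdGraph 3).edgeSet ∧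
              (((∃ x : Site 3, e = s(x, x + Pi.single (2 : Fin 3) 1)) ∧ U e ≤ (p : ℝ)) ∨
                (¬ (∃ x : Site 3, e = s(x, x + Pi.single (2 : Fin 3) 1)) ∧ U e ≤ (p : ℝ)))} ∈
            percolatesAt (0 : Site 3)} =
        theta (zdGraph 3) 0 p) ∧
      (∀ p : unitInterval,
        (labelMeasure (Site 3)).real {U |
          {e | e ∈ (zdGraph 3).edgeSet ∧
              (((∃ x : Site 3, e = s(x, x + Pi.single (2 : Fin 3) 1)) ∧ U e ≤ 0) ∨
                (¬ (∃ x : Site 3, e = s(x, x + Pi.single (2 : Fin 3) 1)) ∧ U e ≤ (p : ℝ)))} ∈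
            percolatesAt (0 : Site 3)} =
        theta (zdGraph 2) 0 p)

end Stubs

/-! ## The same four statements with the crux's `let`-prefix VERBATIM (documentation + check) -/

namespace LetForm

/-- `Stubs.stub_regularity` written with the crux's own `let`-prefix (clauses copied verbatim from
`PercExchangeRateTransport.ModelFacts`). -/
def regularity : Prop :=
  let μ := labelMeasure (Site 3)
  let vert : Sym2 (Site 3) → Prop := fun e => ∃ x : Site 3, e = s(x, x + Pi.single (2 : Fin 3) 1)
  let cfg : ℝ → ℝ → (Sym2 (Site 3) → ℝ) → Set (Sym2 (Site 3)) := fun p t U =>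
    {e | e ∈ (zdGraph 3).edgeSet ∧ ((vert e ∧ U e ≤ t) ∨ (¬ vert e ∧ U e ≤ p))}
  let Θ : ℕ → ℝ → ℝ → ℝ := fun n p t => μ.real {U | cfg p t U ∈ siteToBoundary 3 n}
  (∀ n, Continuous (fun x : ℝ × ℝ => Θ n x.1 x.2)) ∧
    (∀ n, ContDiffOn ℝ 1 (fun x : ℝ × ℝ => Θ n x.1 x.2) (Set.Ioo 0 1 ×ˢ Set.Ioo 0 1))

/-- `Stubs.stub_coupling` written with the crux's own `let`-prefix (clauses copied verbatim from
`PercExchangeRateTransport.ModelFacts`). -/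
def coupling : Prop :=
  let μ := labelMeasure (Site 3)
  let vert : Sym2 (Site 3) → Prop := fun e => ∃ x : Site 3, e = s(x, x + Pi.single (2 : Fin 3) 1)
  let cfg : ℝ → ℝ → (Sym2 (Site 3) → ℝ) → Set (Sym2 (Site 3)) := fun p t U =>
    {e | e ∈ (zdGraph 3).edgeSet ∧ ((vert e ∧ U e ≤ t) ∨ (¬ vert e ∧ U e ≤ p))}
  let Θ : ℕ → ℝ → ℝ → ℝ := fun n p t => μ.real {U | cfg p t U ∈ siteToBoundary 3 n}
  let θ : ℝ → ℝ → ℝ := fun p t => μ.real {U | cfg p t U ∈ percolatesAt (0 : Site 3)}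
  (∀ n t, Monotone (fun p => Θ n p t)) ∧ (∀ n p, Monotone (fun t => Θ n p t)) ∧
    (∀ p t, Antitone (fun n => Θ n p t)) ∧ (∀ n p t, 0 ≤ Θ n p t ∧ Θ n p t ≤ 1) ∧
      (∀ p t, θ p t = ⨅ n, Θ n p t)

/-- `Stubs.stub_derivPos` written with the crux's own `let`-prefix (clauses copied verbatim from
`PercExchangeRateTransport.ModelFacts`). -/
def derivPos : Prop :=
  let μ := labelMeasure (Site 3)
  let vert : Sym2 (Site 3) → Prop := fun e => ∃ x : Site 3, e = s(x, x + Pi.single (2 : Fin 3) 1)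
  let cfg : ℝ → ℝ → (Sym2 (Site 3) → ℝ) → Set (Sym2 (Site 3)) := fun p t U =>
    {e | e ∈ (zdGraph 3).edgeSet ∧ ((vert e ∧ U e ≤ t) ∨ (¬ vert e ∧ U e ≤ p))}
  let Θ : ℕ → ℝ → ℝ → ℝ := fun n p t => μ.real {U | cfg p t U ∈ siteToBoundary 3 n}
  ∀ n, 1 ≤ n → ∀ p ∈ Set.Ioo (0 : ℝ) 1, ∀ t ∈ Set.Ioo (0 : ℝ) 1, 0 < deriv (fun q => Θ n q t) p

/-- `Stubs.stub_slices` written with the crux's own `let`-prefix (clauses copied verbatim from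
`PercExchangeRateTransport.ModelFacts`). -/
def slices : Prop :=
  let μ := labelMeasure (Site 3)
  let vert : Sym2 (Site 3) → Prop := fun e => ∃ x : Site 3, e = s(x, x + Pi.single (2 : Fin 3) 1)
  let cfg : ℝ → ℝ → (Sym2 (Site 3) → ℝ) → Set (Sym2 (Site 3)) := fun p t U =>
    {e | e ∈ (zdGraph 3).edgeSet ∧ ((vert e ∧ U e ≤ t) ∨ (¬ vert e ∧ U e ≤ p))}
  let θ : ℝ → ℝ → ℝ := fun p t => μ.real {U | cfg p t U ∈ percolatesAt (0 : Site 3)}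
  (∀ p : unitInterval, θ p p = theta (zdGraph 3) 0 p) ∧
    (∀ p : unitInterval, θ p 0 = theta (zdGraph 2) 0 p)

end LetForm

/-- The registered text of `stub_regularity` is the ζ-reduction of the crux's clauses (definitional). -/
example : LetForm.regularity ↔ Stubs.stub_regularity := Iff.rfl

/-- The registered text of `stub_coupling` is the ζ-reduction of the crux's clauses (definitional). -/
example : LetForm.coupling ↔ Stubs.stub_coupling := Iff.rfl

/-- The registered text of `stub_derivPos` is the ζ-reduction of the crux's clauses (definitional). -/
example : LetForm.derivPos ↔ Stubs.stub_derivPos := Iff.rfl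

/-- The registered text of `stub_slices` is the ζ-reduction of the crux's clauses (definitional). -/
example : LetForm.slices ↔ Stubs.stub_slices := Iff.rfl

/-! ## The registered stubs (sorried) -/

/-- **stub 1 (registered) = `Stubs.stub_regularity` verbatim** — clauses (1) ∧ (2) of the crux:
continuity of every `Θ_n` on `ℝ²` and `C¹` on `(0,1)²` (clamped two-parameter polynomial by the
cylinder decomposition over the bonds of `Λ_n`; needs the two-parameter label push-forward).
Size M–L. -/
theorem stub_regularity :
    (∀ n : ℕ, Continuous (fun x : ℝ × ℝ =>
        (labelMeasure (Site 3)).real {U |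
          {e | e ∈ (zdGraph 3).edgeSet ∧
              (((∃ x : Site 3, e = s(x, x + Pi.single (2 : Fin 3) 1)) ∧ U e ≤ x.2) ∨
                (¬ (∃ x : Site 3, e = s(x, x + Pi.single (2 : Fin 3) 1)) ∧ U e ≤ x.1))} ∈
            siteToBoundary 3 n})) ∧
      (∀ n : ℕ, ContDiffOn ℝ 1 (fun x : ℝ × ℝ =>
        (labelMeasure (Site 3)).real {U |
          {e | e ∈ (zdGraph 3).edgeSet ∧
              (((∃ x : Site 3, e = s(x, x + Pi.single (2 : Fin 3) 1)) ∧ U e ≤ x.2) ∨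
                (¬ (∃ x : Site 3, e = s(x, x + Pi.single (2 : Fin 3) 1)) ∧ U e ≤ x.1))} ∈
            siteToBoundary 3 n})
        (Set.Ioo 0 1 ×ˢ Set.Ioo 0 1)) := by
  sorry

/-- **stub 2 (registered) = `Stubs.stub_coupling` verbatim** — clauses (3)–(7) of the crux:
`Θ_n` nondecreasing in `p`, in `t`, nonincreasing in `n`, valued in `[0,1]`, and
`θ = ⨅ n, Θ_n` (monotone coupling; continuity from above with measurability of the pulled-back
one-arm events). Size M. -/
theorem stub_coupling :
    (∀ (n : ℕ) (t : ℝ), Monotone (fun p : ℝ =>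
        (labelMeasure (Site 3)).real {U |
          {e | e ∈ (zdGraph 3).edgeSet ∧
              (((∃ x : Site 3, e = s(x, x + Pi.single (2 : Fin 3) 1)) ∧ U e ≤ t) ∨
                (¬ (∃ x : Site 3, e = s(x, x + Pi.single (2 : Fin 3) 1)) ∧ U e ≤ p))} ∈
            siteToBoundary 3 n})) ∧
      (∀ (n : ℕ) (p : ℝ), Monotone (fun t : ℝ =>
        (labelMeasure (Site 3)).real {U |
          {e | e ∈ (zdGraph 3).edgeSet ∧
              (((∃ x : Site 3, e = s(x, x + Pi.single (2 : Fin 3) 1)) ∧ U e ≤ t) ∨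
                (¬ (∃ x : Site 3, e = s(x, x + Pi.single (2 : Fin 3) 1)) ∧ U e ≤ p))} ∈
            siteToBoundary 3 n})) ∧
      (∀ (p t : ℝ), Antitone (fun n : ℕ =>
        (labelMeasure (Site 3)).real {U |
          {e | e ∈ (zdGraph 3).edgeSet ∧
              (((∃ x : Site 3, e = s(x, x + Pi.single (2 : Fin 3) 1)) ∧ U e ≤ t) ∨
                (¬ (∃ x : Site 3, e = s(x, x + Pi.single (2 : Fin 3) 1)) ∧ U e ≤ p))} ∈
            siteToBoundary 3 n})) ∧
      (∀ (n : ℕ) (p t : ℝ),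
        0 ≤ (labelMeasure (Site 3)).real {U |
              {e | e ∈ (zdGraph 3).edgeSet ∧
                  (((∃ x : Site 3, e = s(x, x + Pi.single (2 : Fin 3) 1)) ∧ U e ≤ t) ∨
                    (¬ (∃ x : Site 3, e = s(x, x + Pi.single (2 : Fin 3) 1)) ∧ U e ≤ p))} ∈
                siteToBoundary 3 n} ∧
        (labelMeasure (Site 3)).real {U |
          {e | e ∈ (zdGraph 3).edgeSet ∧
              (((∃ x : Site 3, e = s(x, x + Pi.single (2 : Fin 3) 1)) ∧ U e ≤ t) ∨
                (¬ (∃ x : Site 3, e = s(x, x + Pi.single (2 : Fin 3) 1)) ∧ U e ≤ p))} ∈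
            siteToBoundary 3 n} ≤ 1) ∧
      (∀ (p t : ℝ),
        (labelMeasure (Site 3)).real {U |
          {e | e ∈ (zdGraph 3).edgeSet ∧
              (((∃ x : Site 3, e = s(x, x + Pi.single (2 : Fin 3) 1)) ∧ U e ≤ t) ∨
                (¬ (∃ x : Site 3, e = s(x, x + Pi.single (2 : Fin 3) 1)) ∧ U e ≤ p))} ∈
            percolatesAt (0 : Site 3)} =
        ⨅ n : ℕ, (labelMeasure (Site 3)).real {U |
            {e | e ∈ (zdGraph 3).edgeSet ∧
                (((∃ x : Site 3, e = s(x, x + Pi.single (2 : Fin 3) 1)) ∧ U e ≤ t) ∨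
                  (¬ (∃ x : Site 3, e = s(x, x + Pi.single (2 : Fin 3) 1)) ∧ U e ≤ p))} ∈
              siteToBoundary 3 n}) := by
  sorry

/-- **stub 3 (registered) = `Stubs.stub_derivPos` verbatim** — clause (8) of the crux:
`0 < ∂_p Θ_n(p,t)` for `n ≥ 1`, `0 < p < 1`, `0 < t < 1` (two-parameter Russo + the straight
`x`-path pivotal with positive probability). Size L. -/
theorem stub_derivPos :
    ∀ n : ℕ, 1 ≤ n → ∀ p ∈ Set.Ioo (0 : ℝ) 1, ∀ t ∈ Set.Ioo (0 : ℝ) 1,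
      0 < deriv (fun q : ℝ =>
        (labelMeasure (Site 3)).real {U |
          {e | e ∈ (zdGraph 3).edgeSet ∧
              (((∃ x : Site 3, e = s(x, x + Pi.single (2 : Fin 3) 1)) ∧ U e ≤ t) ∨
                (¬ (∃ x : Site 3, e = s(x, x + Pi.single (2 : Fin 3) 1)) ∧ U e ≤ q))} ∈
            siteToBoundary 3 n}) p := by
  sorry

/-- **stub 4 (registered) = `Stubs.stub_slices` verbatim** — clauses (9) ∧ (10) of the crux:
the diagonal is bond percolation on `ℤ³` and the planar end is (a.s.) bond percolation on `ℤ²`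
(`map_configOfLabels_holds` after a set identity; null-set modification + graph-embedding transport
of `theta`). Size L; the planar half is the hardest piece of the crux. -/
theorem stub_slices :
    (∀ p : unitInterval,
        (labelMeasure (Site 3)).real {U |
          {e | e ∈ (zdGraph 3).edgeSet ∧
              (((∃ x : Site 3, e = s(x, x + Pi.single (2 : Fin 3) 1)) ∧ U e ≤ (p : ℝ)) ∨
                (¬ (∃ x : Site 3, e = s(x, x + Pi.single (2 : Fin 3) 1)) ∧ U e ≤ (p : ℝ)))} ∈
            percolatesAt (0 : Site 3)} =
        theta (zdGraph 3) 0 p) ∧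
      (∀ p : unitInterval,
        (labelMeasure (Site 3)).real {U |
          {e | e ∈ (zdGraph 3).edgeSet ∧
              (((∃ x : Site 3, e = s(x, x + Pi.single (2 : Fin 3) 1)) ∧ U e ≤ 0) ∨
                (¬ (∃ x : Site 3, e = s(x, x + Pi.single (2 : Fin 3) 1)) ∧ U e ≤ (p : ℝ)))} ∈
            percolatesAt (0 : Site 3)} =
        theta (zdGraph 2) 0 p) := by
  sorry

/-! ## The composition (proved): the four stubs imply the crux BY NAME -/

/-- **`ModelFacts` from the four stubs** (hypotheses = the declared stub `Prop`s by name;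
conclusion = the route decl `PercExchangeRateTransport.ModelFacts` by name; no `sorry`): unfold
the four stub definitions (δ), unfold the crux and zeta-reduce its `let`-prefix (δ + ζ), and
reassemble the ten clauses in the crux's order (1),(2) ← stub 1; (3)–(7) ← stub 2; (8) ← stub 3;
(9),(10) ← stub 4. -/
theorem ModelFacts_of (h1 : Stubs.stub_regularity) (h2 : Stubs.stub_coupling)
    (h3 : Stubs.stub_derivPos) (h4 : Stubs.stub_slices) :
    Summit.CriticalPhenomena.PercolationContinuityZ3.Theses.PercExchangeRateTransport.ModelFacts := by
  dsimp only [Stubs.stub_regularity] at h1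
  dsimp only [Stubs.stub_coupling] at h2
  dsimp only [Stubs.stub_derivPos] at h3
  dsimp only [Stubs.stub_slices] at h4
  dsimp only [Summit.CriticalPhenomena.PercolationContinuityZ3.Theses.PercExchangeRateTransport.ModelFacts]
  exact ⟨h1.1, h1.2, h2.1, h2.2.1, h2.2.2.1, h2.2.2.2.1, h2.2.2.2.2, h3, h4.1, h4.2⟩

/-- **The skeleton IS the crux proof** (D-0027 §3.3): `ModelFacts` from the four registered
stubs; sorry-free as soon as `stub_regularity`, `stub_coupling`, `stub_derivPos`, `stub_slices`
are discharged (it also certifies that each registered `theorem stub_*` has the type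
`Stubs.stub_*`). -/
theorem ModelFacts_proof :
    Summit.CriticalPhenomena.PercolationContinuityZ3.Theses.PercExchangeRateTransport.ModelFacts :=
  ModelFacts_of stub_regularity stub_coupling stub_derivPos stub_slices

end Summit.CriticalPhenomena.PercolationContinuityZ3.Cruxes.ModelFacts.Birth

end
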